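import Mathlib
import HarnessLib
import Literature.AlgebraicGeometry.Ramification.InertiaNormalSylow
import Literature.AlgebraicGeometry.Resolution.ResolutionOfSingularities
import Literature.AlgebraicGeometry.Resolution.ComponentGluing
import Literature.AlgebraicGeometry.Resolution.RegularCentreBlowupSeqExtension
import Literature.AlgebraicGeometry.Resolution.MarkedIdealsEtale
import Literature.AlgebraicGeometry.Resolution.KollarBlowupSequenceFunctors
import Summits.ResolutionOfSingularities.ResolutionOfSingularities.Theorems.WildQuotientsWildQuotientResolutionTwoTameCoresPhaseZero
import Summits.ResolutionOfSingularities.ResolutionOfSingularities.Theorems.WildQuotientsWildQuotientResolutionTameCentreSNCBoundary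

/-!
# Phase 0 in EVERY dimension for groups with a LIST of tame cores: one tame move per core
# (crux `WildQuotients.WildQuotientResolution`, stub `stub_phaseZeroHighDim`)

Crux stmt-ResolutionOfSingularities-15640 (`WildQuotientResolution`), registered stub `stub_phaseZeroHighDim`.
The standard-form route of this lineage, iterated: for normal subgroups `M₁, …, M_k ⊴ G` of order prime to `p`
such that every element `h ≠ 1` of order prime to `p` of every subgroup without a normal Sylow `p`-subgroup has
`Mᵢ ≤ ⟨h⟩` for some `i`, Phase 0 holds for every crux datum in every dimension: blow up the inert loci of
`M₁, …, M_k` in turn (✓`tameMove'` p822186), carrying the boundary of exceptional divisors and their strict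
transforms. Invariants along the way: the boundary has simple normal crossings (✓`hasSNCWith_inertLocus_of_hasSNC`
p822531 + tree `HasSNCWith.hasSNC_transform`), its members are `G`-INVARIANT ideal sheaves (exceptional divisors
of `G`-stable centres; strict transforms by `comap_strictTransformIdeal_of_flat`), and for every processed core
`M` the inert loci `Z_⟨g⟩`, `M ≤ ⟨g⟩`, lie in the union of the boundary supports (set-theoretic persistence). At
the end the standard-form criterion (✓p821758) applies at every point: a tame `g ≠ 1` of `I_x` has some core in
`⟨g⟩`, so `Z_⟨g⟩` lies in the boundary, hence (primality, `exists_mem_stalkIdeal_le_augIdeal_of_subset_iUnion`)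
in ONE boundary divisor through `x`, whose line is stable (invariance ⇒ stable support ⇒ ✓p821951).

**Theorem** (`phaseZero_of_tameCores`); corollaries for concrete classes are left to users: e.g. `G ⧸ N` a `p`-group with `N` cyclic of any order prime to `p` (take the `Mᵢ` = the subgroups
of prime order of `N`) — all `C_m ⋊ P`, all dihedral groups `D_m` (`m` odd) in characteristic `2`.

[OURS · crux stmt-ResolutionOfSingularities-15640 · helper toward `stub_phaseZeroHighDim` (an all-dimensional
k-move SLICE of the stub; NOT a proof of the stub); counted 0; AI-level work, weaker than expert review.]
[folklore]
-/

-- single-problem summit: the doubled namespace component `ResolutionOfSingularities` is forced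
set_option linter.dupNamespace false

noncomputable section

open CategoryTheory AlgebraicGeometry TopologicalSpace IsLocalRing
open Literature.AlgebraicGeometry.Resolution Literature.AlgebraicGeometry.Ramification
open Scheme.IdealSheafData
open Summit.ResolutionOfSingularities.ResolutionOfSingularities.Theorems.WildQuotientResolution.PointBlowupStalkData
open Summit.ResolutionOfSingularities.ResolutionOfSingularities.Theorems.WildQuotientResolution.InertLocusStalk

namespace Summit.ResolutionOfSingularities.ResolutionOfSingularities.Theorems.WildQuotientResolution.StandardForm

/-! ## Persistence through a finite union of boundary divisors -/

section Union

variable {X : Scheme.{0}} {G : Type} [Group G] [Finite G] (σ : G →* Aut X) (p : ℕ) [Fact p.Prime]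
  (x : X) [IsRegularLocalRing (X.presheaf.stalk x)] [CharP (ResidueField (X.presheaf.stalk x)) p]
  {I : Subgroup G} (a : I → (X.presheaf.stalk x ⟶ X.presheaf.stalk x))
  (τ : I →* (X.presheaf.stalk x ≃+* X.presheaf.stalk x))
  (hkey : ∀ g : I, Spec.map (a g) ≫ X.fromSpecStalk x = X.fromSpecStalk x ≫ (σ (g : G)).hom)
  (hτ : ∀ (g : I) (r : X.presheaf.stalk x), τ g r = (a g⁻¹).hom r)

include hkey hτ

/-- **Germ form**: if `I(⋃_{D ∈ L} supp D)_x ≤ 𝔞_{τ g}` (`g ∈ I_x` tame, regular stalk), some `D ∈ L` passes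
through `x` with `I(supp D)_x ≤ 𝔞_{τ g}` (`𝔞_{τ g}` is prime). [folklore] -/
theorem exists_mem_of_stalkIdeal_suppUnion_le (g : I) (hg : (orderOf g).Coprime p)
    (hgx : (g : G) ∈ inertiaSubgroup σ x) :
    ∀ (L : List X.IdealSheafData), stalkIdeal (vanishingIdeal (⟨⋃ D' ∈ L, (D'.support : Set X),
      Set.Finite.isClosed_biUnion (List.finite_toSet L) fun D' _ => D'.support.isClosed⟩ : Closeds X)) x ≤ augIdeal (τ g) →
      ∃ D ∈ L, x ∈ D.support ∧ stalkIdeal (vanishingIdeal D.support) x ≤ augIdeal (τ g) := by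
  have hprime := isPrime_augIdeal σ p x a τ hkey hτ g hg hgx
  intro L
  induction L with
  | nil =>
    intro h
    exfalso
    have hempty : (⟨⋃ D' ∈ ([] : List X.IdealSheafData), (D'.support : Set X),
        Set.Finite.isClosed_biUnion (List.finite_toSet []) fun D' _ => D'.support.isClosed⟩ : Closeds X) = ⊥ := by
      ext y; simp
    rw [hempty] at h
    have htop : stalkIdeal (vanishingIdeal (⊥ : Closeds X)) x = ⊤ := by
      apply stalkIdeal_eq_top_of_not_mem_support
      rw [← SetLike.mem_coe, Scheme.IdealSheafData.coe_support_vanishingIdeal]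
      exact fun h => h
    rw [htop, top_le_iff] at h
    exact hprime.ne_top h
  | cons D L ih =>
    intro h
    have hunion : (⟨⋃ D' ∈ (D :: L), (D'.support : Set X),
        Set.Finite.isClosed_biUnion (List.finite_toSet (D :: L)) fun D' _ => D'.support.isClosed⟩ : Closeds X) =
        D.support ⊔ ⟨⋃ D' ∈ L, (D'.support : Set X),
          Set.Finite.isClosed_biUnion (List.finite_toSet L) fun D' _ => D'.support.isClosed⟩ := by
      ext y
      simp
    rw [hunion, vanishingIdeal_sup, stalkIdeal_inf] at h
    rcases hprime.inf_le.mp h with hD | hB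
    · refine ⟨D, List.mem_cons_self, ?_, hD⟩
      by_contra hxD
      have : stalkIdeal (vanishingIdeal D.support) x = ⊤ := by
        have hsupp : (vanishingIdeal D.support).support = D.support :=
          TopologicalSpace.Closeds.ext (Scheme.IdealSheafData.coe_support_vanishingIdeal (Z := D.support))
        exact stalkIdeal_eq_top_of_not_mem_support (hsupp ▸ hxD)
      rw [this, top_le_iff] at hD
      exact hprime.ne_top hD
    · obtain ⟨D', hD', hx', hle⟩ := ih hB
      exact ⟨D', List.mem_cons_of_mem D hD', hx', hle⟩

/-- **The germ of a tame inert locus inside a finite union of divisors lies in one of them**: if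
`Z_⟨g⟩ ⊆ ⋃_{D ∈ L} supp D` (`g ∈ I_x` tame, regular stalk, `Z_⟨g⟩` closed), some `D ∈ L` passes through `x` with
`I(supp D)_x ≤ 𝔞_{τ g}`. [folklore] -/
theorem exists_mem_stalkIdeal_le_augIdeal_of_subset_iUnion (g : I) (hg : (orderOf g).Coprime p)
    (hgx : (g : G) ∈ inertiaSubgroup σ x)
    (hZ : IsClosed {y : X | Subgroup.zpowers (g : G) ≤ inertiaSubgroup σ y}) (L : List X.IdealSheafData)
    (h : {y : X | Subgroup.zpowers (g : G) ≤ inertiaSubgroup σ y} ⊆ ⋃ D ∈ L, (D.support : Set X)) :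
    ∃ D ∈ L, x ∈ D.support ∧ stalkIdeal (vanishingIdeal D.support) x ≤ augIdeal (τ g) := by
  refine exists_mem_of_stalkIdeal_suppUnion_le σ p x a τ hkey hτ g hg hgx L fun z hz => ?_
  have hle : (⟨{y : X | Subgroup.zpowers (g : G) ≤ inertiaSubgroup σ y}, hZ⟩ : Closeds X) ≤
      (⟨⋃ D' ∈ L, (D'.support : Set X),
        Set.Finite.isClosed_biUnion (List.finite_toSet L) fun D' _ => D'.support.isClosed⟩ : Closeds X) :=
    fun y hy => h hy
  exact mem_augIdeal_of_mem_stalkIdeal_inertLocus σ p x a τ hkey hτ g hg hgx hZ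
    (stalkIdeal_mono (vanishingIdeal_antimono hle) x hz)

end Union

/-! ## Invariant ideal sheaves along equivariant morphisms -/

section Invariance

variable {X Y : Scheme.{0}} {G : Type} [Group G] (σ : G →* Aut X) (ρ : G →* Aut Y) (π : X ⟶ Y)
  (hequiv : ∀ g : G, (σ g).hom ≫ π = π ≫ (ρ g).hom)

/-- The support of an invariant ideal sheaf is stable. [folklore] -/
theorem preimage_support_of_comap_eq {D : X.IdealSheafData} (g : G) (h : D.comap (σ g).hom = D) :
    (σ g).hom.base ⁻¹' (D.support : Set X) = D.support := by
  have h' := congrArg (fun I : X.IdealSheafData => ((I.support : Closeds X) : Set X)) h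
  simp only [support_comap] at h'
  exact h'

include hequiv

/-- The pull-back of an invariant ideal sheaf along an equivariant morphism is invariant. [folklore] -/
theorem comap_comap_of_invariant {J : Y.IdealSheafData} (hJ : ∀ g : G, J.comap (ρ g).hom = J) (g : G) :
    (J.comap π).comap (σ g).hom = J.comap π := by
  rw [← comap_comp, hequiv g, comap_comp, hJ g]

/-- The strict transform of an invariant ideal sheaf with respect to an invariant centre is invariant
(✓`comap_strictTransformIdeal_of_flat` for the automorphism square). [folklore] -/
theorem strictTransformIdeal_comap_of_invariant [IsLocallyNoetherian X] {C K : Y.IdealSheafData}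
    (hC : ∀ g : G, C.comap (ρ g).hom = C) (hK : ∀ g : G, K.comap (ρ g).hom = K) (g : G) :
    (strictTransformIdeal π C K).comap (σ g).hom = strictTransformIdeal π C K := by
  rw [comap_strictTransformIdeal_of_flat (ρ g).hom (hequiv g) C K, hC g, hK g]

end Invariance

/-! ## The induction over the cores -/

section Induction

variable (p : ℕ) [Fact p.Prime] (k : Type) [Field k] [CharP k p] {G : Type} [Group G] [Finite G]

/-- **p-standardisation along a list of tame cores** (the inductive engine). Given a model `X` (integral, regular,
invariant separated structure map to `Spec k`, faithful action, stable affine cover) with a simple normal crossings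
boundary `E` of INVARIANT ideal sheaves, and cores already processed (`done`: their `Z_⟨g⟩`'s lie in the boundary),
blowing up the inert loci of the cores `Ms` in turn yields an equivariant proper birational regular model with the
same structure, on which the `Z_⟨g⟩`'s of ALL cores in `done ++ Ms` lie in the boundary. [folklore] -/
theorem standardise_tameCores :
    ∀ (Ms : List (Subgroup G)), (∀ M ∈ Ms, M.Normal ∧ M ≠ ⊥ ∧ (Nat.card M).Coprime p) →
    ∀ (X : Scheme.{0}) (s : X ⟶ Spec (.of k)) [IsSeparated s] [LocallyOfFiniteType s] [IsIntegral X]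
      (ρ : G →* Aut X) (_ : Function.Injective ρ) (_ : Scheme.IsRegular X)
      (_ : ∀ g : G, (ρ g).hom ≫ s = s)
      (_ : ∀ y : X, ∃ O : X.Opens, IsAffineOpen O ∧ y ∈ O ∧ ∀ g : G, (ρ g).hom ⁻¹ᵁ O = O)
      (E : List X.IdealSheafData) (_ : HasSNC E) (_ : ∀ D ∈ E, ∀ g : G, D.comap (ρ g).hom = D)
      (done : List (Subgroup G))
      (_ : ∀ M ∈ done, ∀ g : G, (orderOf g).Coprime p → M ≤ Subgroup.zpowers g →
        {y : X | Subgroup.zpowers g ≤ inertiaSubgroup ρ y} ⊆ ⋃ D ∈ E, (D.support : Set X)),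
    ∃ (Xs : Scheme.{0}) (π : Xs ⟶ X) (ρs : G →* Aut Xs) (Es : List Xs.IdealSheafData),
      IsProper π ∧ IsBirational π ∧ IsIntegral Xs ∧ Scheme.IsRegular Xs ∧
      (∀ g : G, (ρs g).hom ≫ π = π ≫ (ρ g).hom) ∧
      (∀ x : Xs, ∃ U : Xs.Opens, IsAffineOpen U ∧ x ∈ U ∧ ∀ g : G, (ρs g).hom ⁻¹ᵁ U = U) ∧
      HasSNC Es ∧ (∀ D ∈ Es, ∀ g : G, D.comap (ρs g).hom = D) ∧
      (∀ M ∈ done ++ Ms, ∀ g : G, (orderOf g).Coprime p → M ≤ Subgroup.zpowers g →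
        {y : Xs | Subgroup.zpowers g ≤ inertiaSubgroup ρs y} ⊆ ⋃ D ∈ Es, (D.support : Set Xs)) := by
  intro Ms
  induction Ms with
  | nil =>
    intro _ X s _ _ _ ρ hfaith hreg hρ hcov E hE hEinv done hdone
    refine ⟨X, 𝟙 X, ρ, E, inferInstance, isBirational_id X, ‹_›, hreg, fun g => by simp, hcov, hE, hEinv, ?_⟩
    simpa using hdone
  | cons M Ms ih =>
    intro hMs X s _ _ _ ρ hfaith hreg hρ hcov E hE hEinv done hdone
    have hp : p.Prime := Fact.out
    obtain ⟨hMn, hMbot, hMcop⟩ := hMs M List.mem_cons_self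
    haveI := hMn
    haveI : IsLocallyNoetherian X := LocallyOfFiniteType.isLocallyNoetherian s
    have hchar : ∀ z : X, CharP (ResidueField (X.presheaf.stalk z)) p := fun z =>
      (((IsLocalRing.residue (X.presheaf.stalk z)).comp ((X.presheaf.germ ⊤ z trivial).hom.comp
        ((s.appTop).hom.comp (Scheme.ΓSpecIso (.of k)).inv.hom))).charP_iff_charP p).mp inferInstance
    -- the move along `Z_M`
    obtain ⟨X₁, π₁, ρ₁, hπ₁p, hbir₁, hX₁, hreg₁, hequiv₁, hbl₁, hle₁, hcov₁, hfaith₁, hρ₁⟩ :=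
      tameMove' p hp k X s G ρ hfaith hreg hρ hcov M hMbot hMcop
    haveI := hπ₁p; haveI := hX₁
    haveI : IsLocallyNoetherian X₁ := LocallyOfFiniteType.isLocallyNoetherian (π₁ ≫ s)
    have hZ : IsClosed {y : X | M ≤ inertiaSubgroup ρ y} :=
      PointMoveNoNpcCurves.isClosed_setOf_le_inertia s ρ hρ M
    set Z : Closeds X := ⟨{y : X | M ≤ inertiaSubgroup ρ y}, hZ⟩ with hZdef
    set 𝒥 : X.IdealSheafData := vanishingIdeal Z with h𝒥def
    have h𝒥inv : ∀ g : G, 𝒥.comap (ρ g).hom = 𝒥 := comap_vanishingIdeal_inertLocus ρ M hZ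
    -- the new boundary
    set E₁ : List X₁.IdealSheafData := E.map (strictTransformIdeal π₁ 𝒥) ++ [𝒥.comap π₁] with hE₁def
    have hEstab : ∀ D ∈ E, ∀ g : G, (ρ g).hom.base ⁻¹' (D.support : Set X) = D.support :=
      fun D hD g => preimage_support_of_comap_eq ρ g (hEinv D hD g)
    have hsncW : HasSNCWith E 𝒥 := hasSNCWith_inertLocus_of_hasSNC ρ p M hchar hMcop hZ E hE hEstab
    have hE₁ : HasSNC E₁ := hsncW.hasSNC_transform hbl₁
    have hE₁inv : ∀ D ∈ E₁, ∀ g : G, D.comap (ρ₁ g).hom = D := by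
      intro D hD g
      rw [hE₁def, List.mem_append, List.mem_map, List.mem_singleton] at hD
      rcases hD with ⟨D₀, hD₀, rfl⟩ | rfl
      · exact strictTransformIdeal_comap_of_invariant ρ₁ ρ π₁ hequiv₁ h𝒥inv (hEinv D₀ hD₀) g
      · exact comap_comap_of_invariant ρ₁ ρ π₁ hequiv₁ h𝒥inv g
    -- supports upstairs
    have hexc : ((𝒥.comap π₁).support : Set X₁) = π₁.base ⁻¹' {y : X | M ≤ inertiaSubgroup ρ y} := by
      rw [support_comap]
      change π₁.base ⁻¹' ((𝒥.support : Closeds X) : Set X) = _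
      rw [h𝒥def, Scheme.IdealSheafData.coe_support_vanishingIdeal]
      rfl
    have hunion₁ : ∀ D ∈ E, π₁.base ⁻¹' (D.support : Set X) ⊆ ⋃ D' ∈ E₁, (D'.support : Set X₁) := by
      intro D hD y hy
      rcases preimage_support_subset_strict_union_exceptional π₁ 𝒥 D hy with h | h
      · exact Set.mem_biUnion (show strictTransformIdeal π₁ 𝒥 D ∈ E₁ by
          rw [hE₁def]; exact List.mem_append_left _ (List.mem_map.mpr ⟨D, hD, rfl⟩)) h
      · exact Set.mem_biUnion (show 𝒥.comap π₁ ∈ E₁ by rw [hE₁def]; simp) h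
    -- persistence for `done`, establishment for `M`
    have hdone₁ : ∀ M' ∈ done ++ [M], ∀ g : G, (orderOf g).Coprime p → M' ≤ Subgroup.zpowers g →
        {y : X₁ | Subgroup.zpowers g ≤ inertiaSubgroup ρ₁ y} ⊆ ⋃ D ∈ E₁, (D.support : Set X₁) := by
      intro M' hM' g hg hMg y hy
      have hy' : π₁.base y ∈ {y : X | Subgroup.zpowers g ≤ inertiaSubgroup ρ y} :=
        le_trans hy (hle₁ y)
      rw [List.mem_append, List.mem_singleton] at hM'
      rcases hM' with hM' | rfl
      · obtain ⟨D, hD, hyD⟩ := Set.mem_iUnion₂.mp (hdone M' hM' g hg hMg hy')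
        exact hunion₁ D hD (show y ∈ π₁.base ⁻¹' (D.support : Set X) from hyD)
      · refine Set.mem_biUnion (show 𝒥.comap π₁ ∈ E₁ by rw [hE₁def]; simp) ?_
        rw [SetLike.mem_coe, ← SetLike.mem_coe, hexc]
        exact le_trans hMg hy'
    -- recurse
    obtain ⟨X₂, π₂, ρ₂, E₂, hπ₂p, hbir₂, hX₂, hreg₂, hequiv₂, hcov₂, hE₂, hE₂inv, hdone₂⟩ :=
      ih (fun M' hM' => hMs M' (List.mem_cons_of_mem M hM')) X₁ (π₁ ≫ s) ρ₁ hfaith₁ hreg₁ hρ₁ hcov₁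
        E₁ hE₁ hE₁inv (done ++ [M]) hdone₁
    haveI := hπ₂p
    refine ⟨X₂, π₂ ≫ π₁, ρ₂, E₂, inferInstance, ComponentGluing.IsBirational.comp hbir₂ hbir₁, hX₂, hreg₂,
      fun g => ?_, hcov₂, hE₂, hE₂inv, ?_⟩
    · rw [← Category.assoc, hequiv₂ g, Category.assoc, hequiv₁ g, Category.assoc]
    · intro M' hM'
      refine hdone₂ M' ?_
      simpa [List.append_assoc] using hM'

end Induction

/-! ## The theorem -/

/-- **Phase 0 in every dimension for groups with a list of tame cores** (crux stmt-ResolutionOfSingularities-15640,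
a k-move SLICE of `stub_phaseZeroHighDim`). Let `Ms` be a list of normal subgroups of `G`, each non-trivial of
order prime to `p`, such that every element `h ≠ 1` of order prime to `p` of every subgroup without a normal Sylow
`p`-subgroup has `M ≤ ⟨h⟩` for some `M ∈ Ms`. Then the conclusion of `stub_phaseZeroHighDim` holds for every crux
datum (`X′` integral regular of any dimension, finite over the separated finite-type `X₁/k`, `char k = p`,
faithful action over `q`). [folklore] -/
theorem phaseZero_of_tameCores (p : ℕ) (hp : p.Prime) (k : Type) [Field k] [CharP k p]
    (X' X₁ : Scheme.{0}) (f : X₁ ⟶ Spec (.of k)) (q : X' ⟶ X₁) (G : Type) [Group G] [Finite G]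
    (ρ : G →* Aut X') (hfaith : Function.Injective ρ)
    [IsSeparated f] [LocallyOfFiniteType f] [QuasiCompact f] [IsIntegral X']
    (hreg : Scheme.IsRegular X') [IsFinite q] (hρ : ∀ g : G, (ρ g).hom ≫ q = q)
    (Ms : List (Subgroup G)) (hMs : ∀ M ∈ Ms, M.Normal ∧ M ≠ ⊥ ∧ (Nat.card M).Coprime p)
    (hcore : ∀ H : Subgroup G, ¬ HasNormalSylow p H → ∀ h ∈ H, h ≠ 1 → (orderOf h).Coprime p →
      ∃ M ∈ Ms, M ≤ Subgroup.zpowers h) :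
    ∃ (Xs : Scheme.{0}) (π : Xs ⟶ X') (ρs : G →* Aut Xs), IsProper π ∧ IsBirational π ∧
      IsIntegral Xs ∧ Scheme.IsRegular Xs ∧ (∀ g : G, (ρs g).hom ≫ π = π ≫ (ρ g).hom) ∧
      (∀ x : Xs, HasNormalSylow p (inertiaSubgroup ρs x)) ∧
      ∀ x : Xs, ∃ U : Xs.Opens, IsAffineOpen U ∧ x ∈ U ∧ ∀ g : G, (ρs g).hom ⁻¹ᵁ U = U := by
  classical
  haveI : Fact p.Prime := ⟨hp⟩
  set s₀ : X' ⟶ Spec (.of k) := q ≫ f with hs₀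
  obtain ⟨hρ₀, hcov₀⟩ := iterHypotheses_of_cruxData X' X₁ f q ρ hρ
  haveI : IsLocallyNoetherian X' := LocallyOfFiniteType.isLocallyNoetherian s₀
  obtain ⟨Xs, π, ρs, Es, hπp, hbir, hXs, hXsreg, hequiv, hcov, hEs, hEsinv, hest⟩ :=
    standardise_tameCores p k Ms hMs X' s₀ ρ hfaith hreg hρ₀ hcov₀ [] (hasSNC_nil_of_isRegular hreg)
      (fun D hD => absurd hD (by simp)) [] (fun M hM => absurd hM (by simp))
  haveI := hπp; haveI := hXs
  have hρs : ∀ g : G, (ρs g).hom ≫ (π ≫ s₀) = π ≫ s₀ := fun g => by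
    rw [← Category.assoc, hequiv g, Category.assoc, hρ₀ g]
  have hcharS : ∀ x : Xs, CharP (ResidueField (Xs.presheaf.stalk x)) p := fun x =>
    (((IsLocalRing.residue (Xs.presheaf.stalk x)).comp ((Xs.presheaf.germ ⊤ x trivial).hom.comp
      (((π ≫ s₀).appTop).hom.comp (Scheme.ΓSpecIso (.of k)).inv.hom))).charP_iff_charP p).mp inferInstance
  have hZ' : ∀ K : Subgroup G, IsClosed {x : Xs | K ≤ inertiaSubgroup ρs x} := fun K =>
    PointMoveNoNpcCurves.isClosed_setOf_le_inertia (π ≫ s₀) ρs hρs K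
  have hEstab : ∀ D ∈ Es, ∀ g : G, (ρs g).hom.base ⁻¹' (D.support : Set Xs) = D.support :=
    fun D hD g => preimage_support_of_comap_eq ρs g (hEsinv D hD g)
  refine ⟨Xs, π, ρs, hπp, hbir, hXs, hXsreg, hequiv, fun x => ?_, hcov⟩
  haveI := hcharS x
  haveI := hXsreg x
  -- boundary members through `x`
  let T := {D' : Xs.IdealSheafData // D' ∈ Es ∧ x ∈ D'.support}
  haveI hTfin : Finite T :=
    (((List.finite_toSet Es).subset (fun D' (h : D' ∈ Es ∧ x ∈ D'.support) => h.1)).to_subtype :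
      Finite {D' : Xs.IdealSheafData | D' ∈ Es ∧ x ∈ D'.support})
  haveI : Fintype T := Fintype.ofFinite T
  let n := Fintype.card T
  let e : T ≃ Fin n := Fintype.equivFin T
  obtain ⟨hregx, u, hu, ⟨ι, hιinj, hι⟩, -⟩ := hEs x
  have hrsop : IsRsopPart (u ∘ id) := isRsopPart_comp_of_rsop rfl u hu id Function.injective_id
  let z : Fin n → Xs.presheaf.stalk x := fun i => u (ι (e.symm i))
  have hzT : ∀ D' : T, z (e D') = u (ι D') := fun D' => by simp only [z, Equiv.symm_apply_apply]
  have hvs : ∀ D' : T, stalkIdeal (vanishingIdeal D'.1.support) x = Ideal.span {u (ι D')} := fun D' => by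
    rw [hEs.vanishingIdeal_support D'.2.1, hι D']
  by_contra hnpc
  have htame := hcore (inertiaSubgroup ρs x) hnpc
  refine hnpc (hasNormalSylow_inertia_of_standardForm ρs p x fun a τ hkey hτ =>
    ⟨n, z, fun i => hu ▸ Ideal.subset_span ⟨_, rfl⟩, fun i => hrsop.not_mem_sq _, fun g i => ?_,
      fun g hg1 hg => ?_⟩)
  · -- (hstab): every boundary member is invariant, hence has stable support
    exact apply_mem_span_of_stalkIdeal_eq_span ρs x a τ hkey hτ (e.symm i).1.support
      (fun g => hEstab _ (e.symm i).2.1 (g : G)) (hvs (e.symm i)) g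
  · -- (hfix): some core lies in `⟨g⟩`, so `Z_⟨g⟩` lies in the boundary, hence in one divisor through `x`
    have hg1' : (g : G) ≠ 1 := fun h => hg1 (Subtype.ext h)
    obtain ⟨M, hM, hMg⟩ := htame (g : G) g.2 hg1' (by rwa [Subgroup.orderOf_coe])
    have hsub : {y : Xs | Subgroup.zpowers (g : G) ≤ inertiaSubgroup ρs y} ⊆ ⋃ D ∈ Es, (D.support : Set Xs) :=
      hest M (by simpa using hM) (g : G) (by rwa [Subgroup.orderOf_coe]) hMg
    obtain ⟨D, hD, hxD, hle⟩ :=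
      exists_mem_stalkIdeal_le_augIdeal_of_subset_iUnion ρs p x a τ hkey hτ g hg g.2 (hZ' _) Es hsub
    refine ⟨e ⟨D, hD, hxD⟩, ?_⟩
    rw [hzT]
    exact Ideal.mem_sup_left (hle ((hvs ⟨D, hD, hxD⟩) ▸ Ideal.mem_span_singleton_self _))

end Summit.ResolutionOfSingularities.ResolutionOfSingularities.Theorems.WildQuotientResolution.StandardForm

end
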